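import Summits.CriticalPhenomena.Ising3D.Control2DDiagonalSign
import Mathlib.Analysis.SpecialFunctions.Pow.Real
import Mathlib.Tactic.Linarith
import Mathlib.Tactic.Positivity
import Mathlib.Tactic.Ring
import Mathlib.Tactic.FieldSimp
import HarnessLib

/-!
# Crossing at `Δ_σ > 0` forces quasi-primaries of unbounded dimension — WITHOUT the convergence clause
(cell `pub-ising3x`, seat controls-1 gen 43; PAPER §6.2 / Appendix E — CONTROL-ONLY; part 5, completing
`Control2DUnboundedSpectrum`)

HONEST FRAMING: lottery ticket; floor = tightest certified 3D Ising CFT bounds; no exact-solution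
claim without a proof. CONTROL-ONLY (`d = 2`, global `sl(2) × sl(2)` blocks, `Δ_σ = s` an INPUT, axiom set
`A2D′`); nothing here is about `d = 3`, no certificate, functional or number of the record is touched, and no
new hypothesis or named fact enters.

WHAT THIS FILE ADDS. `Control2DUnboundedSpectrum.exists_nonzero_above` / `infinite_above` carried the hypothesis
`OpeConvergent` (convergence of `Σ p_i g_i` on the open square) — a theorem for every statement class of the record
(`Control2DFourPoint`), but a hypothesis nonetheless. It is REDUNDANT: a unitary solution of the POINTWISE sum rule whose
non-zero coefficients all sit at dimensions `≤ H` has `Σ p_i < ∞` already, because at the two diagonal points of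
`Control2DDiagonalSign` every sum-rule term of such a label is `≤ -c · p_i` (`exists_crossF_quarter_neg` for
`2s - δ ≤ Δ_i ≤ H` at `x = 1/4`, `exists_crossF_low_neg` for `Δ_i ≤ 2s - δ` near `x = 1`) while the terms are absolutely
summable (a `HasSum` over a real family). Hence:

* `CrossingData.summable_p_of_bounded_free` — unitary + `SatisfiesCrossing s` + `0 < s` + (all non-zero coefficients at
  `Δ_i ≤ H`) ⇒ `Summable p`; `opeConvergent_of_bounded` — ⇒ `OpeConvergent` (the envelope bounds every block by
  `2K²/(1-m)^{2}` at `m = max(z,z̄)`);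
* **`CrossingData.exists_nonzero_above_free`** — EVERY unitary solution of the typed sum rule at `Δ_σ = s > 0` has, above
  every `H`, a label with `p_i ≠ 0` and `Δ_i > H`; **`infinite_above_free`**; `not_bddAbove_dims` (the set of dimensions
  carrying non-zero OPE coefficients is unbounded). NO convergence, gap or location hypothesis. (`infinite_support` of
  part 2 is the special case `H = 0`.)

NOT claimed: the same for SPIN (`Control2DUnboundedSpin.exists_spin_gt` keeps its convergence clause: a datum with
bounded spins may have unbounded dimensions, and then nothing here controls its low scalars); anything at `s = 0`;
rates / densities; Virasoro; anything three-dimensional; any new bound; no number of the record touched.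

References: R. Rattazzi, V. S. Rychkov, E. Tonni, A. Vichi, JHEP 12 (2008) 031, §3 [cite: RattazziEtAl2008, §3];
F. A. Dolan, H. Osborn, Nucl. Phys. B 678 (2004) 491, §3 [cite: DolanOsborn2004, §3]. Tree: `exists_crossF_quarter_neg`,
`exists_crossF_low_neg` (`Control2DDiagonalSign`); `exists_globalBlock_diag_le_envelope` (`Control2DChiralEnvelope`);
`globalBlock_le_diag`, `globalBlock_nonneg`, `OpeConvergent` (`Control2DFourPoint`); `exists_nonzero_above`
(`Control2DUnboundedSpectrum`). Mathlib: `Summable.abs`, `Summable.of_nonneg_of_le`, `Set.Finite.bddAbove`.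
-/

namespace Summit.CriticalPhenomena.Ising3D.Control2D

open Set
open Literature.MathematicalPhysics.QuantumFieldTheory.ConformalBootstrap3D

namespace CrossingData

variable {D : CrossingData} {s : ℝ}

/-- **Bounded effective spectrum ⇒ summable OPE coefficients, from the pointwise sum rule alone.** If every label with
`p_i ≠ 0` has `Δ_i ≤ H`, then `Σ p_i < ∞`: with `δ, c₁` of `exists_crossF_quarter_neg H` and `x₂, c₂` of
`exists_crossF_low_neg`, every label has `p_i ≤ c₁⁻¹ |p_i F_i(1/4,1/4)| + c₂⁻¹ |p_i F_i(x₂,x₂)|`, and both families on the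
right are summable (the sum rule is a `HasSum` over a real family at each point). [folklore] -/
theorem summable_p_of_bounded_free (hU : D.IsUnitary) (hC : D.SatisfiesCrossing s) (hs : 0 < s) {H : ℝ}
    (hB : ∀ i, D.p i ≠ 0 → D.Δ i ≤ H) : Summable D.p := by
  obtain ⟨δ, c₁, hδ0, hδs, hc₁, h₁⟩ := exists_crossF_quarter_neg H hs
  obtain ⟨x₂, c₂, hx₂, hx₂1, hc₂, h₂⟩ := exists_crossF_low_neg hs hδ0
  have hq : (1 / 4 : ℝ) ∈ Ioo (0 : ℝ) 1 := ⟨by norm_num, by norm_num⟩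
  have hx : x₂ ∈ Ioo (0 : ℝ) 1 := ⟨by linarith, hx₂1⟩
  have S1 := ((hC (1 / 4) (1 / 4) hq hq).summable.abs).mul_left c₁⁻¹
  have S2 := ((hC x₂ x₂ hx hx).summable.abs).mul_left c₂⁻¹
  refine (S1.add S2).of_nonneg_of_le (fun i => (hU i).2.2) fun i => ?_
  have hp0 : 0 ≤ D.p i := (hU i).2.2
  have hA : 0 ≤ c₁⁻¹ * |D.p i * crossF s (-1) (globalBlock (D.Δ i) (D.spin i)) (1 / 4) (1 / 4)| :=
    mul_nonneg (inv_nonneg.mpr hc₁.le) (abs_nonneg _)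
  have hB' : 0 ≤ c₂⁻¹ * |D.p i * crossF s (-1) (globalBlock (D.Δ i) (D.spin i)) x₂ x₂| :=
    mul_nonneg (inv_nonneg.mpr hc₂.le) (abs_nonneg _)
  by_cases hp : D.p i = 0
  · linarith [hA, hB']
  have hH := hB i hp
  rcases le_or_gt (2 * s - δ) (D.Δ i) with hhi | hlo
  · -- the range `2s - δ ≤ Δ_i ≤ H`: the quarter point
    have hF := h₁ (D.Δ i) (D.spin i) (hU i).2.1 hhi hH
    have habs : c₁ * D.p i ≤ |D.p i * crossF s (-1) (globalBlock (D.Δ i) (D.spin i)) (1 / 4) (1 / 4)| := by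
      rw [abs_mul, abs_of_nonneg hp0]
      have : c₁ ≤ |crossF s (-1) (globalBlock (D.Δ i) (D.spin i)) (1 / 4) (1 / 4)| := by
        rw [abs_of_neg (by linarith)]; linarith
      nlinarith
    have : D.p i ≤ c₁⁻¹ * |D.p i * crossF s (-1) (globalBlock (D.Δ i) (D.spin i)) (1 / 4) (1 / 4)| :=
      calc D.p i = c₁⁻¹ * (c₁ * D.p i) := by field_simp
        _ ≤ _ := mul_le_mul_of_nonneg_left habs (inv_nonneg.mpr hc₁.le)
    linarith
  · -- the range `Δ_i < 2s - δ`: the point `x₂`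
    have hF := h₂ (D.Δ i) (D.spin i) (hU i).2.1 hlo.le
    have habs : c₂ * D.p i ≤ |D.p i * crossF s (-1) (globalBlock (D.Δ i) (D.spin i)) x₂ x₂| := by
      rw [abs_mul, abs_of_nonneg hp0]
      have : c₂ ≤ |crossF s (-1) (globalBlock (D.Δ i) (D.spin i)) x₂ x₂| := by
        rw [abs_of_neg (by linarith)]; linarith
      nlinarith
    have : D.p i ≤ c₂⁻¹ * |D.p i * crossF s (-1) (globalBlock (D.Δ i) (D.spin i)) x₂ x₂| :=
      calc D.p i = c₂⁻¹ * (c₂ * D.p i) := by field_simp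
        _ ≤ _ := mul_le_mul_of_nonneg_left habs (inv_nonneg.mpr hc₂.le)
    linarith

/-- **Bounded effective spectrum ⇒ OPE convergence on the open square** (pointwise sum rule alone): `Σ p_i < ∞` and every
block with `Δ_i ≤ H` is `≤ 2K²/(1-m)²` at `(z,z̄)`, `m = max(z,z̄)` (the envelope with `ε = 1`). [folklore] -/
theorem opeConvergent_of_bounded (hU : D.IsUnitary) (hC : D.SatisfiesCrossing s) (hs : 0 < s) {H : ℝ}
    (hB : ∀ i, D.p i ≠ 0 → D.Δ i ≤ H) : D.OpeConvergent := by
  intro z zb hz hzb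
  have hP := summable_p_of_bounded_free hU hC hs hB
  obtain ⟨K, hK0, hK⟩ := exists_globalBlock_diag_le_envelope H (ε := 1) one_pos
  set m : ℝ := max z zb with hm
  have hm0 : 0 < m := lt_max_of_lt_left hz.1
  have hm1 : m < 1 := max_lt hz.2 hzb.2
  refine (hP.mul_right (2 * (K / (1 - m) ^ (1 : ℝ)) ^ 2)).of_nonneg_of_le
    (fun i => mul_nonneg (hU i).2.2 (globalBlock_nonneg (hU i).2.1 hz hzb)) fun i => ?_
  by_cases hp : D.p i = 0
  · simp [hp]
  · have h1 := globalBlock_le_diag (hU i).2.1 hz hzb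
    have h2 := hK (D.Δ i) (D.spin i) (hU i).2.1 (hB i hp) m hm0 hm1
    exact mul_le_mul_of_nonneg_left (h1.trans h2) (hU i).2.2

/-- **No bounded effective spectrum — hypothesis-free.** EVERY unitary solution of the typed `⟨σσσσ⟩` sum rule at
`Δ_σ = s > 0` has, above every `H`, a label with non-zero squared OPE coefficient: no convergence, gap or location
hypothesis (the convergence clause of `exists_nonzero_above` is derived from the boundedness being refuted,
`opeConvergent_of_bounded`). [folklore] -/
theorem exists_nonzero_above_free (hU : D.IsUnitary) (hC : D.SatisfiesCrossing s) (hs : 0 < s) (H : ℝ) :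
    ∃ i, D.p i ≠ 0 ∧ H < D.Δ i := by
  by_contra hneg
  push Not at hneg
  exact absurd (exists_nonzero_above hU hC hs (opeConvergent_of_bounded hU hC hs hneg) H) (by
    push Not; exact hneg)

/-- **Infinitely many labels above every bound — hypothesis-free.** [folklore] -/
theorem infinite_above_free (hU : D.IsUnitary) (hC : D.SatisfiesCrossing s) (hs : 0 < s) (H : ℝ) :
    {i | D.p i ≠ 0 ∧ H < D.Δ i}.Infinite := by
  intro hfin
  obtain ⟨B, hB⟩ := (hfin.image D.Δ).bddAbove
  obtain ⟨i, hp, hH⟩ := exists_nonzero_above_free hU hC hs (max H B)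
  have hi : i ∈ {i | D.p i ≠ 0 ∧ H < D.Δ i} := ⟨hp, lt_of_le_of_lt (le_max_left _ _) hH⟩
  have hle : D.Δ i ≤ B := hB (Set.mem_image_of_mem D.Δ hi)
  have := le_max_right H B
  linarith

/-- **The dimensions carrying non-zero OPE coefficients form an unbounded set** (as real numbers, so in particular an
infinite set of DISTINCT dimensions), for every unitary typed solution at `Δ_σ > 0`. [folklore] -/
theorem not_bddAbove_dims (hU : D.IsUnitary) (hC : D.SatisfiesCrossing s) (hs : 0 < s) :
    ¬ BddAbove {d : ℝ | ∃ i, D.p i ≠ 0 ∧ D.Δ i = d} := by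
  rintro ⟨H, hH⟩
  obtain ⟨i, hp, hlt⟩ := exists_nonzero_above_free hU hC hs H
  have : D.Δ i ≤ H := hH ⟨i, hp, rfl⟩
  linarith

/-- The set of dimensions carrying non-zero OPE coefficients is infinite (unbounded sets of reals are infinite).
[folklore] -/
theorem infinite_dims (hU : D.IsUnitary) (hC : D.SatisfiesCrossing s) (hs : 0 < s) :
    {d : ℝ | ∃ i, D.p i ≠ 0 ∧ D.Δ i = d}.Infinite :=
  fun hfin => not_bddAbove_dims hU hC hs hfin.bddAbove

/-- **At `Δ_σ = 1/8`**: every unitary solution of the typed sum rule — whatever its scalars and spins, no statement-class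
hypothesis, no use of the record — has non-zero OPE coefficients above every dimension `H` (so `record_unbounded_spectrum`
of part 2 no longer needs `record_fourPoint_crossing`). CONTROL-ONLY. [folklore] -/
theorem unbounded_spectrum_eighth (D : CrossingData) (hU : D.IsUnitary) (hC : D.SatisfiesCrossing (1 / 8))
    (H : ℝ) : {i | D.p i ≠ 0 ∧ H < D.Δ i}.Infinite :=
  infinite_above_free hU hC (by norm_num) H

end CrossingData

end Summit.CriticalPhenomena.Ising3D.Control2D
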